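import Mathlib
import Summits.Ventures.HodgeRepro.Tier4.Target
import Summits.Ventures.HodgeRepro.Tier4.Line3.Defs
import Summits.Ventures.HodgeRepro.Tier4.Line3.DefsLemmas
import Summits.Ventures.HodgeRepro.Tier4.Line3.OffMainOrbit

/-!
# Tier4/Line3/OrbitInvariant — the Gram sizes are orbit invariants; the depth-`N` ball eventually misses a fixed
off-main orbit (the whole content of L3.4 `term_tendsto_zero`, stated on the support clause)

Blind re-derivation cell `pub-hodge-repro`, Tier 4 «PROVE THE STEP» (README §9–§10), LINE L3 (orbit expansion of the
quadruple theta period), seat t4-x2 (reserve wall-breaker) on L3.4 `term_tendsto_zero` (lead S12446 / S12473).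

THE ANGLE (different from the skeleton docstring's analytic route «the Gaussian beats the index `q₀^{9dN}`»): the header's
step 4 taken literally — a FIXED off-main orbit is EVENTUALLY DISJOINT from the depth-`N` ball, so the orbital term is
`0` from some depth on, and no field of the localiser other than `supp` is needed (no `growth`, no `level_le`, no domain
volume, no Gaussian).

* `norm_embedding_eq_one_of_torus`: a norm-one scalar `t` (`c(t) t = 1`) of the CM field `E′` has `‖σ t‖ = 1` at EVERY
  complex embedding `σ` (`σ ∘ c = conj ∘ σ`, Mathlib `IsCMField.complexEmbedding_complexConj`).
* the Gram size `‖σ ⟨x_i, x_j⟩_H‖` is invariant under the torus `(E′^1)^4` (`absGram_smul`) and under `U(H)(E′)`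
  (`absGram_unitary`, from the skeleton's `hform_unitary`), hence an invariant of the rational orbit of the line tuple
  (`absGram_of_orbitOf_eq`, by induction on `Relation.EqvGen orbitStepL` through the chosen representatives,
  `lineStep_out`); `absGram_eq_of_orbitOf_eq` pins the sizes of every tuple on the orbit `o` to those of `rep (out o)`.
* `norm_gram_sub_le`: on a fixed orbit the Gram deviation `σ(⟨x_i,x_j⟩ − ⟨xm_i,xm_j⟩)` is bounded by the crude sum of all
  Gram sizes of the orbit's representative and of `xm`, uniformly in `x`, `σ`, `i`, `j`.
* `eventually_coefQ_eq_zero`: for a family of translates whose quadruple coefficient function is supported (up to the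
  torus) in the two-sided depth-`N` ball `xm + (𝔭 𝔭̄)^N L`, `L` in a finite set of lattices (the clause `Loc.supp` of the
  skeleton, v0.16+), every line tuple of a fixed off-main orbit has coefficient `0` from a depth `N₀` on: otherwise the
  landed `exists_gram_dev_size` (t4-L2-p3, `Tier4/Line3/OffMainOrbit.lean`) gives `N(𝔭)^N ≤ ‖σ D₀‖^d ‖σ α_ij‖^d ≤
  (Σ_σ ‖σ D₀‖^d) · M^d` (`M` the bound of `norm_gram_sub_le`), independent of `N`, against `N(𝔭) ≥ 2`.
* `eventually_term_eq_zero` / `tendsto_term_zero_of_supp`: every summand of the orbital series of `o` vanishes for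
  `N ≥ N₀`, so `term_N(o) = ∫_{D_N} 0 = 0` and `term_N(o) → 0` (`tendsto_const_nhds.congr'`).

`Tier4/Line3/TermTendstoZero.lean` consumes `tendsto_term_zero_of_supp` with `ℓ.supp` for the registered L3.4 statement.
Nothing here asserts anything about the truth of (P); HC_CM is NOT proved by anyone in this repository.
-/

set_option autoImplicit false

noncomputable section

namespace Summit.Ventures.HodgeRepro.Tier4.Line3

open Matrix NumberField Filter Topology

namespace T4Data

variable (X : T4Data)

/-! ### Norm-one scalars have absolute value one at every embedding -/

/-- A norm-one scalar of the CM field (`c(t) t = 1`) has absolute value `1` at every complex embedding. -/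
theorem norm_embedding_eq_one_of_torus (σ : X.E →+* ℂ) {t : X.E} (ht : X.c t * t = 1) : ‖σ t‖ = 1 := by
  have h1 : σ (X.c t) = (starRingEnd ℂ) (σ t) := IsCMField.complexEmbedding_complexConj X.E σ t
  have h2 : σ (X.c t) * σ t = 1 := by rw [← map_mul, ht, map_one]
  rw [h1, Complex.conj_mul'] at h2
  have h3 : ‖σ t‖ ^ 2 = 1 := by exact_mod_cast h2
  exact (pow_eq_one_iff_of_nonneg (norm_nonneg _) two_ne_zero).mp h3

/-- `‖σ (c t)‖ = ‖σ t‖` at every complex embedding. -/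
theorem norm_embedding_c (σ : X.E →+* ℂ) (t : X.E) : ‖σ (X.c t)‖ = ‖σ t‖ := by
  have h1 : σ (X.c t) = (starRingEnd ℂ) (σ t) := IsCMField.complexEmbedding_complexConj X.E σ t
  rw [h1, Complex.norm_conj]

/-! ### The archimedean sizes of the Gram entries are orbit invariants -/

/-- Scaling the four vectors by norm-one scalars does not change the archimedean Gram sizes. -/
theorem absGram_smul (t : Fin 4 → X.E) (ht : ∀ j, X.c (t j) * t j = 1) (x : X.Tuple) (σ : X.E →+* ℂ)
    (i j : Fin 4) : ‖σ (X.gram (fun j => t j • x j) i j)‖ = ‖σ (X.gram x i j)‖ := by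
  simp only [gram]
  rw [X.hform_smul, map_mul, map_mul, norm_mul, norm_mul, X.norm_embedding_c,
    X.norm_embedding_eq_one_of_torus σ (ht i), X.norm_embedding_eq_one_of_torus σ (ht j)]
  ring

/-- Moving the tuple by `g ∈ U(H)(E′)` does not change the Gram sizes. -/
theorem absGram_unitary {g : Matrix (Fin 3) (Fin 3) X.E} (hg : IsUnitaryOf X.c X.H g) (x : X.Tuple)
    (σ : X.E →+* ℂ) (i j : Fin 4) : ‖σ (X.gram (fun j => g *ᵥ x j) i j)‖ = ‖σ (X.gram x i j)‖ := by
  simp only [gram]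
  rw [X.hform_unitary hg]

/-- The chosen representative of the line tuple of `x` has the Gram sizes of `x`. -/
theorem absGram_rep_lines (x : X.Tuple) (σ : X.E →+* ℂ) (i j : Fin 4) :
    ‖σ (X.gram (X.rep (X.lines x)) i j)‖ = ‖σ (X.gram x i j)‖ := by
  choose t ht hout using fun j => X.lineStep_out (x j)
  have hrep : X.rep (X.lines x) = fun j => t j • x j := by
    funext j
    exact hout j
  rw [hrep]
  exact X.absGram_smul t ht x σ i j

/-- One step of `U(H)(E′)` on line tuples preserves the Gram sizes of the representatives. -/
theorem absGram_of_orbitStepL {w w' : X.LineTuple} (h : X.orbitStepL w w') (σ : X.E →+* ℂ) (i j : Fin 4) :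
    ‖σ (X.gram (X.rep w') i j)‖ = ‖σ (X.gram (X.rep w) i j)‖ := by
  obtain ⟨g, hg, hw⟩ := h
  choose t ht hout using fun j => X.lineStep_out (g *ᵥ Quot.out (w j))
  have hrep : X.rep w' = fun j => t j • (g *ᵥ X.rep w j) := by
    funext j
    show Quot.out (w' j) = _
    rw [hw j]
    exact hout j
  rw [hrep, X.absGram_smul t ht _ σ i j, X.absGram_unitary hg _ σ i j]

/-- **THE GRAM SIZES ARE ORBIT INVARIANTS**: line tuples on the same rational orbit have representatives with the same
archimedean Gram sizes. -/
theorem absGram_of_orbitOf_eq {w w' : X.LineTuple} (h : X.orbitOf w = X.orbitOf w') (σ : X.E →+* ℂ) (i j : Fin 4) :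
    ‖σ (X.gram (X.rep w) i j)‖ = ‖σ (X.gram (X.rep w') i j)‖ := by
  have h' : Relation.EqvGen X.orbitStepL w w' := Quot.eqvGen_exact h
  clear h
  induction h' with
  | rel a b hab => exact (X.absGram_of_orbitStepL hab σ i j).symm
  | refl a => rfl
  | symm a b _ ih => exact ih.symm
  | trans a b c _ _ ih1 ih2 => exact ih1.trans ih2

/-- A tuple on the orbit `o` has the Gram sizes of the chosen representative of `o`. -/
theorem absGram_eq_of_orbitOf_eq (x : X.Tuple) (o : X.Orbit) (h : X.orbitOf (X.lines x) = o) (σ : X.E →+* ℂ)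
    (i j : Fin 4) : ‖σ (X.gram x i j)‖ = ‖σ (X.gram (X.rep (Quot.out o)) i j)‖ := by
  rw [← X.absGram_rep_lines x σ i j]
  apply X.absGram_of_orbitOf_eq
  rw [h]
  exact (Quot.out_eq o).symm

/-! ### The Gram deviation from the main tuple is BOUNDED on a fixed orbit -/

/-- On a fixed orbit the Gram deviation from `xm` is bounded, uniformly in the tuple and the embedding, by the crude
sum of all the Gram sizes of the orbit's chosen representative and of `xm` (finitely many embeddings). -/
theorem norm_gram_sub_le (o : X.Orbit) (xm x : X.Tuple) (hx : X.orbitOf (X.lines x) = o) (σ : X.E →+* ℂ)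
    (i j : Fin 4) : ‖σ (X.gram x i j - X.gram xm i j)‖ ≤
      ∑ σ' : X.E →+* ℂ, ∑ i' : Fin 4, ∑ j' : Fin 4,
        (‖σ' (X.gram (X.rep (Quot.out o)) i' j')‖ + ‖σ' (X.gram xm i' j')‖) := by
  have h1 : ‖σ (X.gram x i j - X.gram xm i j)‖ ≤
      ‖σ (X.gram (X.rep (Quot.out o)) i j)‖ + ‖σ (X.gram xm i j)‖ := by
    rw [map_sub, ← X.absGram_eq_of_orbitOf_eq x o hx σ i j]
    exact norm_sub_le _ _
  refine h1.trans ?_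
  have hnn : ∀ (σ : X.E →+* ℂ) (i j : Fin 4),
      0 ≤ ‖σ (X.gram (X.rep (Quot.out o)) i j)‖ + ‖σ (X.gram xm i j)‖ :=
    fun σ i j => add_nonneg (norm_nonneg _) (norm_nonneg _)
  calc ‖σ (X.gram (X.rep (Quot.out o)) i j)‖ + ‖σ (X.gram xm i j)‖
      ≤ ∑ j' : Fin 4, (‖σ (X.gram (X.rep (Quot.out o)) i j')‖ + ‖σ (X.gram xm i j')‖) :=
        Finset.single_le_sum (fun j' _ => hnn σ i j') (Finset.mem_univ j)
    _ ≤ ∑ i' : Fin 4, ∑ j' : Fin 4, (‖σ (X.gram (X.rep (Quot.out o)) i' j')‖ + ‖σ (X.gram xm i' j')‖) :=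
        Finset.single_le_sum (fun i' _ => Finset.sum_nonneg fun j' _ => hnn σ i' j') (Finset.mem_univ i)
    _ ≤ ∑ σ' : X.E →+* ℂ, ∑ i' : Fin 4, ∑ j' : Fin 4,
          (‖σ' (X.gram (X.rep (Quot.out o)) i' j')‖ + ‖σ' (X.gram xm i' j')‖) :=
        Finset.single_le_sum
          (fun σ' _ => Finset.sum_nonneg fun i' _ => Finset.sum_nonneg fun j' _ => hnn σ' i' j') (Finset.mem_univ σ)

/-! ### The depth-`N` ball eventually misses every fixed off-main orbit -/

/-- `N(𝔭) ≥ 2` for a height-one prime of the ring of integers. -/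
theorem one_lt_absNorm (p : IsDedekindDomain.HeightOneSpectrum (RingOfIntegers X.E)) :
    1 < (Ideal.absNorm p.asIdeal : ℝ) := by
  have h0 : Ideal.absNorm p.asIdeal ≠ 0 := by
    rw [Ne, Ideal.absNorm_eq_zero_iff]
    exact p.ne_bot
  have h1 : Ideal.absNorm p.asIdeal ≠ 1 := by
    rw [Ne, Ideal.absNorm_eq_one_iff]
    exact p.isPrime.ne_top
  have h2 : 1 < Ideal.absNorm p.asIdeal := by omega
  exact_mod_cast h2

/-- **THE BALL EVENTUALLY MISSES A FIXED OFF-MAIN ORBIT.** For a family of translates whose quadruple coefficient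
function is supported (up to the torus) in the two-sided depth-`N` ball around the symmetric main tuple `xm`
(the clause `Loc.supp`), every line tuple of a fixed orbit `o ≠ [xm]` has coefficient `0` from some depth on. -/
theorem eventually_coefQ_eq_zero (D : X.ThetaData) (p : IsDedekindDomain.HeightOneSpectrum (RingOfIntegers X.E))
    (S : Finset (Submodule (RingOfIntegers X.E) (Fin 3 → X.E))) (hS : ∀ L ∈ S, X.IsLattice L)
    (xm : X.Tuple) (h02 : xm 2 = xm 0) (h13 : xm 3 = xm 1) (hab : LinearIndependent X.E ![xm 0, xm 1])
    (level : ℕ → X.Level) (loc : ∀ N : ℕ, X.Tr (level N))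
    (hsupp : ∀ N (w : X.LineTuple), X.coefQ D.cf (loc N) (X.rep w) ≠ 0 → ∃ x : X.Tuple, X.lines x = w ∧
      ∃ L ∈ S, ∀ j, x j - xm j ∈ X.ballIdeal p N • L)
    (o : X.Orbit) (ho : o ≠ X.orbitOf (X.lines xm)) :
    ∃ N₀ : ℕ, ∀ N, N₀ ≤ N → ∀ w : X.LineTuple, X.orbitOf w = o → X.coefQ D.cf (loc N) (X.rep w) = 0 := by
  obtain ⟨D₀, hD₀, hrung⟩ := X.exists_gram_dev_size p S (fun L hL => (hS L hL).1) xm h02 h13 hab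
  have hq := X.one_lt_absNorm p
  obtain ⟨N₀, hN₀⟩ := Filter.eventually_atTop.mp
    ((tendsto_pow_atTop_atTop_of_one_lt hq).eventually (eventually_gt_atTop
      ((∑ σ : X.E →+* ℂ, ‖σ (D₀ : X.E)‖ ^ Module.finrank ℚ X.E) *
        (∑ σ' : X.E →+* ℂ, ∑ i' : Fin 4, ∑ j' : Fin 4,
          (‖σ' (X.gram (X.rep (Quot.out o)) i' j')‖ + ‖σ' (X.gram xm i' j')‖)) ^ Module.finrank ℚ X.E)))
  refine ⟨N₀, fun N hN w hw => ?_⟩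
  by_contra hne
  obtain ⟨x, hxw, L, hL, hx⟩ := hsupp N w hne
  have hxo : X.orbitOf (X.lines x) = o := by rw [hxw, hw]
  have hxne : X.orbitOf (X.lines x) ≠ X.orbitOf (X.lines xm) := by rw [hxo]; exact ho
  obtain ⟨i, j, σ, hσ⟩ := hrung N x L hL hx hxne
  have hbound := X.norm_gram_sub_le o xm x hxo σ i j
  have hKσ : ‖σ (D₀ : X.E)‖ ^ Module.finrank ℚ X.E ≤ ∑ σ' : X.E →+* ℂ, ‖σ' (D₀ : X.E)‖ ^ Module.finrank ℚ X.E :=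
    Finset.single_le_sum (f := fun σ' : X.E →+* ℂ => ‖σ' (D₀ : X.E)‖ ^ Module.finrank ℚ X.E)
      (fun σ' _ => pow_nonneg (norm_nonneg _) _) (Finset.mem_univ σ)
  have h1 : ‖σ (D₀ : X.E)‖ ^ Module.finrank ℚ X.E * ‖σ (X.gram x i j - X.gram xm i j)‖ ^ Module.finrank ℚ X.E ≤
      (∑ σ' : X.E →+* ℂ, ‖σ' (D₀ : X.E)‖ ^ Module.finrank ℚ X.E) *
        (∑ σ' : X.E →+* ℂ, ∑ i' : Fin 4, ∑ j' : Fin 4,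
          (‖σ' (X.gram (X.rep (Quot.out o)) i' j')‖ + ‖σ' (X.gram xm i' j')‖)) ^ Module.finrank ℚ X.E :=
    mul_le_mul hKσ (pow_le_pow_left₀ (norm_nonneg _) hbound _) (pow_nonneg (norm_nonneg _) _)
      ((pow_nonneg (norm_nonneg _) _).trans hKσ)
  have h2 := hN₀ N hN
  linarith

/-- **OFF THE MAIN ORBIT THE ORBITAL TERM IS EVENTUALLY ZERO**: from the depth `N₀` on, every summand of the orbital
series of `o` vanishes, so the term is the integral of `0`. -/
theorem eventually_term_eq_zero (D : X.ThetaData) (p : IsDedekindDomain.HeightOneSpectrum (RingOfIntegers X.E))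
    (S : Finset (Submodule (RingOfIntegers X.E) (Fin 3 → X.E))) (hS : ∀ L ∈ S, X.IsLattice L)
    (xm : X.Tuple) (h02 : xm 2 = xm 0) (h13 : xm 3 = xm 1) (hab : LinearIndependent X.E ![xm 0, xm 1])
    (level : ℕ → X.Level) (loc : ∀ N : ℕ, X.Tr (level N))
    (hsupp : ∀ N (w : X.LineTuple), X.coefQ D.cf (loc N) (X.rep w) ≠ 0 → ∃ x : X.Tuple, X.lines x = w ∧
      ∃ L ∈ S, ∀ j, x j - xm j ∈ X.ballIdeal p N • L)
    (o : X.Orbit) (ho : o ≠ X.orbitOf (X.lines xm)) :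
    ∃ N₀ : ℕ, ∀ N, N₀ ≤ N → X.term D.Φ D.cf (level N) (loc N) o = 0 := by
  obtain ⟨N₀, hN₀⟩ := X.eventually_coefQ_eq_zero D p S hS xm h02 h13 hab level loc hsupp o ho
  refine ⟨N₀, fun N hN => ?_⟩
  unfold term
  have hz : ∀ z : Fin 2 → ℂ,
      (∑' w : {w : X.LineTuple // X.orbitOf w = o}, X.summand D.Φ D.cf (loc N) w.1 z) = 0 := by
    intro z
    have h0 : ∀ w : {w : X.LineTuple // X.orbitOf w = o}, X.summand D.Φ D.cf (loc N) w.1 z = 0 := by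
      intro w
      unfold summand
      rw [hN₀ N hN w.1 w.2, zero_mul]
    simp only [h0, tsum_zero]
  simp only [hz, MeasureTheory.integral_zero]

/-- The off-main orbital terms of a family of translates supported in the two-sided ball tend to `0` (they are
eventually `0`). -/
theorem tendsto_term_zero_of_supp (D : X.ThetaData) (p : IsDedekindDomain.HeightOneSpectrum (RingOfIntegers X.E))
    (S : Finset (Submodule (RingOfIntegers X.E) (Fin 3 → X.E))) (hS : ∀ L ∈ S, X.IsLattice L)
    (xm : X.Tuple) (h02 : xm 2 = xm 0) (h13 : xm 3 = xm 1) (hab : LinearIndependent X.E ![xm 0, xm 1])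
    (level : ℕ → X.Level) (loc : ∀ N : ℕ, X.Tr (level N))
    (hsupp : ∀ N (w : X.LineTuple), X.coefQ D.cf (loc N) (X.rep w) ≠ 0 → ∃ x : X.Tuple, X.lines x = w ∧
      ∃ L ∈ S, ∀ j, x j - xm j ∈ X.ballIdeal p N • L)
    (o : X.Orbit) (ho : o ≠ X.orbitOf (X.lines xm)) :
    Tendsto (fun N => X.term D.Φ D.cf (level N) (loc N) o) atTop (𝓝 0) := by
  obtain ⟨N₀, hN₀⟩ := X.eventually_term_eq_zero D p S hS xm h02 h13 hab level loc hsupp o ho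
  refine tendsto_const_nhds.congr' ?_
  rw [Filter.EventuallyEq, Filter.eventually_atTop]
  exact ⟨N₀, fun N hN => (hN₀ N hN).symm⟩

end T4Data

end Summit.Ventures.HodgeRepro.Tier4.Line3

end
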